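import Summits.BirchSwinnertonDyer.BirchSwinnertonDyer.Theorems.EdixhovenFibreFiveSevenLTwistTransferIntegrality
import Summits.BirchSwinnertonDyer.BirchSwinnertonDyer.Theorems.EdixhovenFibreFiveSevenLTwistTransferTrace
import Summits.BirchSwinnertonDyer.BirchSwinnertonDyer.Theorems.EdixhovenFibreFiveSevenTwistDegreeStepFiveSevenLTwist
import HarnessLib
/-!
# L-TWIST WITHOUT IHARA: `Λ(f) ⊆ s·Λ(f ⊗ χ_q) + p·Λ(f)` from the TRANSFER CYCLE at an auxiliary prime `q`
# with `p ∤ (q − 1)((q + 1)² − a_q²)` (route `EdixhovenFibreFiveSeven`, crux TDS57 / KP57, `--supports`; ROAD A′ part 3)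

Cell `pub/bsd-wall` (D-0145 line `route-BirchSwinnertonDyer-EdixhovenFibreFiveSeven`), seat `bsd-line-edix-p3`
(prover). Route-free file: THEOREMS ONLY (no definition, no named fact, no `sorry`). BSD is not proved by this file.

The sibling `LTwist.lTwist_of_ihara3` (edix-p2) obtains the twisted-period decomposition L-TWIST from the cite-only
THREE-COPY IHARA LEMMA (`diamondRibet1997_iharaLemma_sq`) and a non-Eisenstein witness prime. Here the SAME
conclusion is proved with NO Ihara input, from the explicit transfer cycle: for `x ∈ H₁(X₀(M), ℤ)` put
`z = (Tr^{Mq²}_{Mq})^∨ (Tr^{Mq}_M)^∨ x ∈ H₁(X₀(Mq²), ℤ)` (`LTwistTransfer.dualMap_restrictLevel_mem_periodHomology`);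
then `(α_*, β_*, γ_*) z = (q(q+1) x, q T_q x, (T_q² − q − 1) x)` (`…Trace`), so by the double twist identity
`(f_χ)_χ = B₁ f − (a_q/q) B_q f + (1/q) B_{q²} f` (`LTwist.charTwist_charTwist_eq`),
`q · z((f_χ)_χ) = (q − 1)((q + 1)² − a_q²) · x(f) ∈ Λ((f_χ)_χ)`; Stevens (5.4) and Bezout finish exactly as in
`LTwist.lTwist_core` PROVIDED `p ∤ (q − 1)((q + 1)² − a_q²)` (`= (q−1)·#Ẽ(𝔽_q)·#Ẽ^{(q)}(𝔽_q)`), i.e.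
`q ≢ 1`, `a_q ≢ ±(q + 1) (mod p)` — a Chebotarev condition on the auxiliary prime replacing Ihara's lemma.

* §A `lTwist_core_transfer` — the core at level `M` (any `T_q`-eigen cusp form with integral `a_q`).
* §B `lTwist_of_transfer` — curve level, verbatim the conclusion of `LTwist.lTwist_of_ihara3` (any newform `g` of
  the twisted curve `Vχ`), hypotheses: `q ∤ 2pN(V₀)` prime and `p ∤ (q − 1)((q + 1)² − a_q(V₀)²)`; no `Addv`, no
  Ihara, no Eisenstein witness.

References: [Shimura1971] Prop. 3.38, (7.2.6), Prop. 3.64; [Stevens1989] Lemma (5.4); [AtkinLi1978] §3 Thm. 3.1;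
[CremonaAlgorithms1997] §2.4; [DarmonDiamondTaylor1995] §4.5 (the lift this file makes explicit on the old part).
-/

set_option autoImplicit false
-- the Theorems directory repeats the summit name (sibling precedent `SignedBaseChangeAssembly.lean`)
set_option linter.dupNamespace false

noncomputable section

open scoped MatrixGroups ModularForm NumberTheorySymbols

open CongruenceSubgroup UpperHalfPlane Matrix.SpecialLinearGroup

namespace Summit.BirchSwinnertonDyer.BirchSwinnertonDyer.Theorems.LTwistTransfer

open Literature.NumberTheory.EllipticCurves.ModularForms Literature.NumberTheory.QuadraticFields

/-! ### §A The core: transfer cycle instead of Ihara's lemma -/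

/-- **The transfer lift.** For `q ∤ M` prime and `x ∈ H₁(X₀(M), ℤ)`, the cycle
`z = (Tr^{Mq²}_{Mq})^∨ (Tr^{Mq}_M)^∨ x` lies in `H₁(X₀(Mq²), ℤ)` and satisfies
`α_* z = q(q+1) x`, `β_* z = q T_q^∨ x`, `γ_* z = (T_q^∨)² x − (q+1) x`
(`α, β, γ : τ ↦ τ, qτ, q²τ`; weight `2`). [cite: Shimura1971, §3.4 Prop. 3.38, §7.2 (7.2.6)] -/
theorem exists_transfer_lift {M q : ℕ} [NeZero M] [NeZero q] [Fact q.Prime] (hqM : ¬ q ∣ M)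
    {x : Module.Dual ℂ (CuspForm (Gamma0 M) 2)} (hx : x ∈ periodHomology M) :
    ∃ z ∈ periodHomology (M * q ^ 2),
      (degeneracyMap0 M (M * q ^ 2) 1 2).dualMap z = ((q : ℂ) * ((q : ℂ) + 1)) • x ∧
      (degeneracyMap0 M (M * q ^ 2) q 2).dualMap z = (q : ℂ) • (heckeT (Gamma0 M) 2 q).dualMap x ∧
      (degeneracyMap0 M (M * q ^ 2) (q ^ 2) 2).dualMap z =
        (heckeT (Gamma0 M) 2 q).dualMap ((heckeT (Gamma0 M) 2 q).dualMap x) - ((q : ℂ) + 1) • x := by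
  obtain ⟨β, hβ10, hβ11⟩ := exists_beta q M hqM
  set Tr₁ := restrictLevel (Gamma0 (M * q)) (Gamma0 M) 2 with hTr₁
  set Tr₂ := restrictLevel (Gamma0 (M * q ^ 2)) (Gamma0 (M * q)) 2 with hTr₂
  refine ⟨Tr₂.dualMap (Tr₁.dualMap x), ?_, ?_, ?_, ?_⟩
  · exact dualMap_restrictLevel_mem_periodHomology (M * q) (M * q ^ 2) ⟨q, by ring⟩
      (isDoubleCosetDecomp_gamma0_mul_level q (M * q) (M * q ^ 2) (by ring) (dvd_mul_left q M))
      (dualMap_restrictLevel_mem_periodHomology M (M * q) (dvd_mul_right M q)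
        (isDoubleCosetDecomp_gamma0_beta q M (M * q) rfl β hβ10 hβ11) hx)
  · ext f
    rw [LinearMap.dualMap_apply, LinearMap.dualMap_apply, LinearMap.dualMap_apply, hTr₁, hTr₂,
      restrictLevel_restrictLevel_degeneracyMap0_one 2 hqM, map_smul, LinearMap.smul_apply]
  · ext f
    rw [LinearMap.dualMap_apply, LinearMap.dualMap_apply, LinearMap.dualMap_apply, hTr₁, hTr₂,
      restrictLevel_restrictLevel_degeneracyMap0_self 2 hqM, map_smul, LinearMap.smul_apply,
      LinearMap.dualMap_apply]
  · ext f
    rw [LinearMap.dualMap_apply, LinearMap.dualMap_apply, LinearMap.dualMap_apply, hTr₁, hTr₂,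
      restrictLevel_restrictLevel_degeneracyMap0_sq 2 hqM, map_sub, map_smul, LinearMap.sub_apply,
      LinearMap.smul_apply, LinearMap.dualMap_apply, LinearMap.dualMap_apply, sub_self, zpow_zero, one_mul]

/-- Bezout tail shared with `LTwist.lTwist_core`: if `u · z ∈ Λ((f_χ)_χ)` for an integer `u` prime to `p`, `p ≠ q`,
then `z ∈ s·Λ(f_χ) + p·Λ(f)` for `z ∈ Λ(f)`, `s² = q*` (Stevens (5.4): `τ(χ)·Λ((f_χ)_χ) ⊆ Λ(f_χ)`, `τ(χ)² = q*`).
[cite: Stevens1989, Lemma (5.4) p. 97] -/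
theorem exists_decomp_of_mul_mem {M q p : ℕ} [NeZero M] [NeZero q] [Fact q.Prime] [Fact p.Prime] (hq2 : q ≠ 2)
    (hqp : q ≠ p) (hχ : (jacobiChar q).IsQuadratic) (f : CuspForm (Gamma0 M) 2)
    {z : ℂ} (hz : z ∈ periodLattice f) (u : ℤ) (hu : ¬ (p : ℤ) ∣ u)
    (hmem : (u : ℂ) * z ∈ periodLattice (charTwist (M * q ^ 2) (dvd_refl _) (dvd_mul_left (q ^ 2) M) hχ
      (charTwist (M * q ^ 2) (dvd_mul_right M (q ^ 2)) (dvd_mul_left (q ^ 2) M) hχ f)))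
    (s : ℂ) (hs2 : s ^ 2 = (((-1 : ℤ) ^ (q / 2) * q : ℤ) : ℂ)) :
    ∃ w ∈ periodLattice (charTwist (M * q ^ 2) (dvd_mul_right M (q ^ 2)) (dvd_mul_left (q ^ 2) M) hχ f),
      ∃ y ∈ periodLattice f, z = s * w + (p : ℂ) * y := by
  have hqP : q.Prime := Fact.out
  have hpP : p.Prime := Fact.out
  have hodd : Odd q := hqP.odd_of_ne_two hq2
  have hprim : (jacobiChar q).IsPrimitive := isPrimitive_jacobiChar hodd hqP.squarefree
  set fχ := charTwist (M * q ^ 2) (dvd_mul_right M (q ^ 2)) (dvd_mul_left (q ^ 2) M) hχ f with hfχ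
  set τ : ℂ := gaussSum (jacobiChar q) (ZMod.stdAddChar (N := q)) with hτ
  set d : ℤ := (-1 : ℤ) ^ (q / 2) * q with hd
  have hmemτ : τ * ((u : ℂ) * z) ∈ periodLattice fχ :=
    gaussSum_mul_mem_periodLattice_of_mem_charTwist (M * q ^ 2) (dvd_refl _) (dvd_mul_left (q ^ 2) M) hχ
      hprim fχ hmem
  have hτ2 : τ ^ 2 = (d : ℂ) := by rw [hτ, LTwist.gaussSum_jacobiChar_sq hq2, hd]
  have hcop : IsCoprime (d * u) (p : ℤ) := by
    have hpZ : Prime (p : ℤ) := Nat.prime_iff_prime_int.mp hpP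
    refine (Prime.coprime_iff_not_dvd hpZ).mpr ?_ |>.symm
    intro hdiv
    rcases hpZ.dvd_or_dvd hdiv with h1 | h1
    · rw [hd] at h1
      rcases hpZ.dvd_or_dvd h1 with h2 | h2
      · have := Int.natAbs_dvd_natAbs.mpr (hpZ.dvd_of_dvd_pow h2)
        simp only [Int.natAbs_neg, Int.natAbs_one, Nat.dvd_one, Int.natAbs_natCast] at this
        exact hpP.one_lt.ne' this
      · exact hqp ((Nat.prime_dvd_prime_iff_eq hpP hqP).mp (Int.natCast_dvd_natCast.mp h2)).symm
    · exact hu h1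
  obtain ⟨α, β, hαβ⟩ := hcop
  have hτs : τ = s ∨ τ = -s := by
    have : τ ^ 2 = s ^ 2 := by rw [hτ2, hs2, hd]
    exact sq_eq_sq_iff_eq_or_eq_neg.mp this |>.imp id id
  have key : z = τ * ((α : ℂ) * (τ * ((u : ℂ) * z))) + (p : ℂ) * ((β : ℂ) * z) := by
    have e1 : ((α * (d * u) + β * p : ℤ) : ℂ) = 1 := by rw [hαβ]; push_cast; ring
    calc z = ((α * (d * u) + β * p : ℤ) : ℂ) * z := by rw [e1, one_mul]
      _ = τ * ((α : ℂ) * (τ * ((u : ℂ) * z))) + (p : ℂ) * ((β : ℂ) * z) := by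
        push_cast; rw [← hτ2]; ring
  rcases hτs with hτs | hτs
  · refine ⟨(α : ℂ) * (τ * ((u : ℂ) * z)), ?_, (β : ℂ) * z, ?_, ?_⟩
    · simpa only [zsmul_eq_mul] using (periodLattice fχ).zsmul_mem hmemτ α
    · simpa only [zsmul_eq_mul] using (periodLattice f).zsmul_mem hz β
    · rw [← hτs]; exact key
  · refine ⟨-((α : ℂ) * (τ * ((u : ℂ) * z))), ?_, (β : ℂ) * z, ?_, ?_⟩
    · exact neg_mem (by simpa only [zsmul_eq_mul] using (periodLattice fχ).zsmul_mem hmemτ α)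
    · simpa only [zsmul_eq_mul] using (periodLattice f).zsmul_mem hz β
    · rw [mul_neg, ← neg_mul, ← hτs]; exact key

/-- **The core of L-TWIST, Ihara-free.** Let `q` be an odd prime with `q ∤ M`, `χ = (·/q)`, `f ∈ S₂(Γ₀(M))` with
`a₀ = 0`, multiplicative coefficients, the good Euler recursion at `q` and `T_q f = a f` with `a = a_q ∈ ℤ` (e.g. the
newform of an elliptic curve of conductor `M`); let `p ≠ q` be a prime with **`p ∤ (q − 1)((q + 1)² − a²)`**. Then
`Λ(f) ⊆ s·Λ(f_χ) + p·Λ(f)` for any `s` with `s² = q*`. Proof: for `z = x(f)`, the transfer lift `z'` of `x`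
(`exists_transfer_lift`) has `z'(B₁ f) = q(q+1) z`, `z'(B_q f) = q a z`, `z'(B_{q²} f) = (a² − q − 1) z`, so by the
double twist identity `q · z'((f_χ)_χ) = (q−1)((q+1)² − a²) · z ∈ Λ((f_χ)_χ)`; then Stevens (5.4) and Bezout
(`exists_decomp_of_mul_mem`). [cite: Shimura1971, Prop. 3.64] [cite: Stevens1989, Lemma (5.4) p. 97] -/
theorem lTwist_core_transfer {M q p : ℕ} [NeZero M] [NeZero q] [Fact q.Prime] [Fact p.Prime] (hq2 : q ≠ 2)
    (hqp : q ≠ p) (hqM : ¬ q ∣ M) (hχ : (jacobiChar q).IsQuadratic)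
    (f : CuspForm (Gamma0 M) 2) (h0 : cuspCoeff f 0 = 0)
    (hmul : ∀ m n : ℕ, m.Coprime n → cuspCoeff f (m * n) = cuspCoeff f m * cuspCoeff f n)
    (hrec : ∀ e : ℕ, cuspCoeff f (q ^ (e + 2)) =
      cuspCoeff f q * cuspCoeff f (q ^ (e + 1)) - q * cuspCoeff f (q ^ e))
    (a : ℤ) (ha : cuspCoeff f q = (a : ℂ)) (hT : heckeT (Gamma0 M) 2 q f = (a : ℂ) • f)
    (hu : ¬ (p : ℤ) ∣ ((q : ℤ) - 1) * (((q : ℤ) + 1) ^ 2 - a ^ 2))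
    (s : ℂ) (hs2 : s ^ 2 = (((-1 : ℤ) ^ (q / 2) * q : ℤ) : ℂ)) :
    ∀ z ∈ periodLattice f,
      ∃ w ∈ periodLattice (charTwist (M * q ^ 2) (dvd_mul_right M (q ^ 2)) (dvd_mul_left (q ^ 2) M) hχ f),
        ∃ y ∈ periodLattice f, z = s * w + (p : ℂ) * y := by
  intro z hz
  have hqP : q.Prime := Fact.out
  have hq0 : (q : ℂ) ≠ 0 := Nat.cast_ne_zero.mpr hqP.ne_zero
  set fχ := charTwist (M * q ^ 2) (dvd_mul_right M (q ^ 2)) (dvd_mul_left (q ^ 2) M) hχ f with hfχ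
  -- the cycle `x` carrying `z` and its transfer lift `z'`
  obtain ⟨x, hx, rfl⟩ := LTwist.exists_mem_periodHomology_apply_eq f hz
  obtain ⟨z', hz', hα, hβ, hγ⟩ := exists_transfer_lift hqM hx
  -- `q · z'((f_χ)_χ) = (q-1)((q+1)² - a²) · x(f)`
  have hdouble := LTwist.charTwist_charTwist_eq (M := M) hq2 hχ f h0 hmul hrec
  have hTx : (heckeT (Gamma0 M) 2 q).dualMap x f = (a : ℂ) * x f := by
    rw [LinearMap.dualMap_apply, hT, map_smul, smul_eq_mul]
  have hTTx : (heckeT (Gamma0 M) 2 q).dualMap ((heckeT (Gamma0 M) 2 q).dualMap x) f = (a : ℂ) * ((a : ℂ) * x f) := by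
    rw [LinearMap.dualMap_apply, hT, map_smul, smul_eq_mul, hTx]
  have heval : z' (charTwist (M * q ^ 2) (dvd_refl _) (dvd_mul_left (q ^ 2) M) hχ fχ) =
      ((((q : ℤ) - 1) * (((q : ℤ) + 1) ^ 2 - a ^ 2) : ℤ) : ℂ) / q * x f := by
    rw [hfχ, hdouble, map_add, map_sub, map_smul, map_smul, smul_eq_mul, smul_eq_mul,
      ← LinearMap.dualMap_apply, ← LinearMap.dualMap_apply, ← LinearMap.dualMap_apply, hα, hβ, hγ,
      LinearMap.smul_apply, LinearMap.smul_apply, LinearMap.sub_apply, LinearMap.smul_apply, hTx, hTTx, ha,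
      smul_eq_mul, smul_eq_mul, smul_eq_mul]
    push_cast
    field_simp
    ring
  -- `u · x(f) ∈ Λ((f_χ)_χ)` with `u = (q-1)((q+1)² - a²)`
  have hmem : ((((q : ℤ) - 1) * (((q : ℤ) + 1) ^ 2 - a ^ 2) : ℤ) : ℂ) * x f ∈
      periodLattice (charTwist (M * q ^ 2) (dvd_refl _) (dvd_mul_left (q ^ 2) M) hχ fχ) := by
    have h1 := (periodLattice _).zsmul_mem (LTwist.apply_mem_periodLattice_of_mem_periodHomology hz'
      (charTwist (M * q ^ 2) (dvd_refl _) (dvd_mul_left (q ^ 2) M) hχ fχ)) (q : ℤ)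
    rw [heval, zsmul_eq_mul] at h1
    convert h1 using 1
    push_cast
    field_simp
  exact exists_decomp_of_mul_mem hq2 hqp hχ f hz _ hu hmem s hs2

/-! ### §B Curve level: any newform of the twisted curve -/

/-- **L-TWIST WITHOUT IHARA (curve level).** For `V₀/ℚ` globally minimal with a conductor-level datum `D₀`
(newform `f`), a prime `q ∤ 2 p N(V₀)` with **`p ∤ (q − 1)((q + 1)² − a_q(V₀)²)`**, a globally minimal model
`Vχ` of `V₀ ⊗ χ_{q*}`, `s² = q*`, and ANY newform `g` of `Vχ` (any level): **`Λ(f) ⊆ s·Λ(g) + p·Λ(f)`** —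
verbatim the conclusion of the sibling `LTwist.lTwist_of_ihara3`, with the three-copy Ihara lemma and the
non-Eisenstein witness REPLACED by the arithmetic condition on `q` (and no additivity hypothesis). Proof:
`lTwist_core_transfer` for `f` (`T_q f = a_q f`, `IsNewform0.heckeT_eq_coeff_smul`; Euler recursion
`LFunction_apply_prime_pow_add_two_of_prime`), then `g = f ⊗ χ_q` at level `N q²` exactly as in the sibling
(Atkin–Li `isNewform0_charTwist_of_isPrimePow_of_coprime`, `lFunction_quadraticTwist_apply_of_hasAdditiveReductionAt`,
strong multiplicity one `IsNewformOf.level_eq_level`). [cite: AtkinLi1978, §3, Thm. 3.1]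
[cite: Stevens1989, Lemma (5.4) p. 97] [cite: Shimura1971, Prop. 3.64] -/
theorem lTwist_of_transfer {p : ℕ} [Fact p.Prime] {q : ℕ} [Fact q.Prime] (V₀ : WeierstrassCurve ℚ) [V₀.IsElliptic]
    [V₀.IsGloballyMinimal] [NeZero (V₀.conductorNorm ℤ)]
    (D₀ : ModularParametrizationData V₀ (V₀.conductorNorm ℤ)) (hq2 : q ≠ 2) (hqp : q ≠ p)
    (hqN : ¬ q ∣ V₀.conductorNorm ℤ)
    (hu : ¬ (p : ℤ) ∣ ((q : ℤ) - 1) * (((q : ℤ) + 1) ^ 2 - V₀.LFunction q ^ 2))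
    (Vχ : WeierstrassCurve ℚ) [Vχ.IsElliptic] [Vχ.IsGloballyMinimal] (v : WeierstrassCurve.VariableChange ℚ)
    (hv : v • V₀.quadraticTwist (((-1 : ℤ) ^ (q / 2) * q : ℤ) : ℚ) = Vχ)
    (s : ℂ) (hs2 : s ^ 2 = (((-1 : ℤ) ^ (q / 2) * q : ℤ) : ℂ))
    {N' : ℕ} [NeZero N'] (g : CuspForm (Gamma0 N') 2) (hg : IsNewformOf Vχ g) :
    ∀ z ∈ periodLattice D₀.f, ∃ w ∈ periodLattice g, ∃ y ∈ periodLattice D₀.f,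
      z = s * w + (p : ℂ) * y := by
  intro z hz
  have hqP : q.Prime := Fact.out
  haveI : NeZero q := ⟨hqP.ne_zero⟩
  set M := V₀.conductorNorm ℤ with hMdef
  set f := D₀.f with hfdef
  have hf : IsNewformOf V₀ f := D₀.isNewformOf
  set d : ℤ := (-1 : ℤ) ^ (q / 2) * q with hd
  obtain ⟨hd4, hdsq, hdabs⟩ := LTwist.pStar_facts hqP hq2
  have hodd : Odd q := hqP.odd_of_ne_two hq2
  have hχ : (jacobiChar q).IsQuadratic := fun a ↦ jacobiChar_trichotomy a
  have hprim : (jacobiChar q).IsPrimitive := isPrimitive_jacobiChar hodd hqP.squarefree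
  -- coefficient laws of `f`
  have ha : ∀ n, cuspCoeff f n = ((V₀.LFunction n : ℤ) : ℂ) := hf.2
  have h0 : cuspCoeff f 0 = 0 := by rw [ha, ArithmeticFunction.map_zero, Int.cast_zero]
  have hmul : ∀ m n : ℕ, m.Coprime n → cuspCoeff f (m * n) = cuspCoeff f m * cuspCoeff f n := by
    intro m n hmn
    rw [ha, ha, ha, V₀.isMultiplicative_LFunction.map_mul_of_coprime hmn, Int.cast_mul]
  have hrec : ∀ e : ℕ, cuspCoeff f (q ^ (e + 2)) =
      cuspCoeff f q * cuspCoeff f (q ^ (e + 1)) - q * cuspCoeff f (q ^ e) := by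
    intro e
    rw [ha, ha, ha, ha, V₀.LFunction_apply_prime_pow_add_two_of_prime hqP e, if_neg hqN]
    push_cast; ring
  have hT : heckeT (Gamma0 M) 2 q f = ((V₀.LFunction q : ℤ) : ℂ) • f := by
    rw [hf.1.heckeT_eq_coeff_smul hqP]
    change cuspCoeff f q • f = _
    rw [ha q]
  -- the Ihara-free core
  obtain ⟨w, hw, y, hy, hzy⟩ := lTwist_core_transfer hq2 hqp hqN hχ f h0 hmul hrec (V₀.LFunction q) (ha q) hT
    hu s hs2 z hz
  -- identification of `g` with `f ⊗ χ` at level `M q²` (as in `LTwist.lTwist_of_ihara3`)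
  set g' := charTwist (M * q ^ 2) (dvd_mul_right M (q ^ 2)) (dvd_mul_left (q ^ 2) M) hχ f with hg'def
  have hd0 : d ≠ 0 := by rw [hd]; exact mul_ne_zero (pow_ne_zero _ (by norm_num)) (by exact_mod_cast hqP.ne_zero)
  have haddtw : ∀ w : IsDedekindDomain.HeightOneSpectrum (NumberField.RingOfIntegers ℚ),
      ((Rat.HeightOneSpectrum.primesEquiv w : ℕ) : ℤ) ∣ d →
      (V₀.quadraticTwist (d : ℚ)).HasAdditiveReductionAt w := by
    intro w hw
    have hℓ : (Rat.HeightOneSpectrum.primesEquiv w : ℕ) = q := by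
      have h1 : (Rat.HeightOneSpectrum.primesEquiv w : ℕ) ∣ d.natAbs := Int.natCast_dvd.mp hw
      rw [hdabs] at h1
      exact (Nat.prime_dvd_prime_iff_eq (Rat.HeightOneSpectrum.primesEquiv w).2 hqP).mp h1
    have hgood' : V₀.HasGoodReductionAt w := by
      have := (V₀.dvd_conductorNorm_iff w).not
      rw [hℓ] at this
      exact not_not.mp (this.mp hqN)
    refine V₀.hasAdditiveReductionAt_quadraticTwist_of_dvd w (by rw [hℓ]; exact hq2) hd0 hw ?_ hgood'
    rw [hℓ]
    intro h
    have h' : q ^ 2 ∣ d.natAbs := Int.natCast_dvd.mp (by exact_mod_cast h)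
    rw [hdabs] at h'
    have := Nat.le_of_dvd hqP.pos h'
    nlinarith [hqP.one_lt]
  have hd0q : ((d : ℤ) : ℚ) ≠ 0 := by exact_mod_cast hd0
  haveI : (V₀.quadraticTwist (d : ℚ)).IsElliptic := V₀.isElliptic_quadraticTwist hd0q
  have hg' : IsNewformOf Vχ g' := by
    refine ⟨isNewform0_charTwist_of_isPrimePow_of_coprime hχ hprim hqP.isPrimePow
      ((Nat.Prime.coprime_iff_not_dvd hqP).mpr hqN).symm hf.1, fun n ↦ ?_⟩
    rw [hg'def, cuspCoeff_charTwist _ _ _ hχ hprim f n, ha n, ← hv, WeierstrassCurve.LFunction_smul,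
      Summit.BirchSwinnertonDyer.Rank1Residual.Additive.lFunction_quadraticTwist_apply_of_hasAdditiveReductionAt
        V₀ hd4 hdsq haddtw n, hdabs, jacobiChar_natCast]
    push_cast; ring
  have hN' : N' = M * q ^ 2 := hg.level_eq_level hg'
  subst hN'
  have hgg' : g = g' := eq_of_forall_cuspCoeff_eq_gamma0 fun n ↦ by rw [hg.2 n, hg'.2 n]
  rw [hgg']
  exact ⟨w, hw, y, hy, hzy⟩

end Summit.BirchSwinnertonDyer.BirchSwinnertonDyer.Theorems.LTwistTransfer

end
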